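import Mathlib
import HarnessLib
import Summits.QuantumFields.YangMills.Theorems.LangevinControlUVFemtoCurvatureTwoPointMirrorPairs

/-!
# Crux `FemtoCurvatureTwoPoint` (stmt-QuantumFields-9363, route `LangevinControlUV`):
# the reference axis covariance is non-negative (reflection positivity), part 2 of 2

Helper for the line `generic-step-gamma-encoding` (lead prover, `--supports stmt-QuantumFields-9363`):
for EVERY compact group `G`, every continuous matrix representation `ρ`, every torus side `L`, every
coupling `β ≥ 0` and every separation `n`,

  `0 ≤ Cov_{L,β}(P_0^{01}, P_{n e₂}^{01})`,  `P_x^{ij}(U) = N − Re tr ρ(U_{p(x;i,j)})`,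

the covariance being taken under Wilson's lattice gauge measure `wilsonMeasure ρ β` on `(ℤ/L)⁴`
(`axisPlaquetteCov_nonneg`, stated with the crux's `let P … let E … let cov` unfolded). This is the SIGN
half of the crux's load-bearing lower clause `c·Γ(n a) ≤ n⁸·Cov` (the line's stub GD⁻
`stub_axisGaussianLower` asserts the size); it disarms the Disproof's kill switch
`not_packageRho_of_frequently_nonpos` in sign for every `(G, ρ)`, and it is the `armCov_nonneg` input of
the sibling crux `FemtoCurvatureSkewness` (with `HypercubicCovSymmetry` for the `e₃` arm).

Proof: transport the pair to the time axis (coordinate permutation `σ = (0 1 2)`, tree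
`wilsonExpectation_comp_configPerm`; translations, tree `wilsonExpectation_comp_torusConfigShift`), then
the mirror-pair positivity of part 1 (`LangevinControlUVFemtoCurvatureTwoPointMirrorPairs`): link mirror
pairs for even `L` and odd `n`, site mirror pairs for even `L` and even `n`, odd-torus mirror pairs for odd
`L ≥ 3` at separation `n` (odd `n`) or `L − n` (even `n`); `n ≡ 0 (mod L)` is a variance.
-/

noncomputable section

open MeasureTheory
open Literature.MathematicalPhysics.QuantumFieldTheory

namespace Summit.QuantumFields.YangMills.Theorems.FemtoCurvatureTwoPoint.AxisCovNonneg

/-! ## Translation, symmetry, variance -/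

section Transport

variable {d L N : ℕ} [NeZero L] {G : Type*} [Group G] [TopologicalSpace G]
  [IsTopologicalGroup G] [CompactSpace G] [MeasurableSpace G] [BorelSpace G]
  (ρ : G →* Matrix (Fin N) (Fin N) ℂ)

omit [NeZero L] [TopologicalSpace G] [IsTopologicalGroup G] [CompactSpace G] [BorelSpace G] in
/-- Plaquette functions of a translated configuration. [folklore] -/
theorem plaqRe_torusConfigShift (v : Site d L) (U : GaugeConfig d L G) (a : Site d L)
    (q : {p : Fin d × Fin d // p.1 < p.2}) :
    WilsonRP.plaqRe ρ (torusConfigShift v U) (a, q) = WilsonRP.plaqRe ρ U (a - v, q) := by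
  simp only [WilsonRP.plaqRe, plaquetteHolonomy_torusConfigShift]

/-- **Translation invariance of plaquette covariances** (torus Wilson state is translation
invariant, tree `wilsonExpectation_comp_torusConfigShift`). [folklore] -/
theorem cov_translate (β : ℝ) (a b v : Site d L) (q : {p : Fin d × Fin d // p.1 < p.2}) :
    wilsonExpectation ρ β (fun U : GaugeConfig d L G =>
        WilsonRP.plaqRe ρ U (a, q) * WilsonRP.plaqRe ρ U (b, q))
      - wilsonExpectation ρ β (fun U : GaugeConfig d L G => WilsonRP.plaqRe ρ U (a, q))
        * wilsonExpectation ρ β (fun U : GaugeConfig d L G => WilsonRP.plaqRe ρ U (b, q)) =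
    wilsonExpectation ρ β (fun U : GaugeConfig d L G =>
        WilsonRP.plaqRe ρ U (a - v, q) * WilsonRP.plaqRe ρ U (b - v, q))
      - wilsonExpectation ρ β (fun U : GaugeConfig d L G => WilsonRP.plaqRe ρ U (a - v, q))
        * wilsonExpectation ρ β (fun U : GaugeConfig d L G => WilsonRP.plaqRe ρ U (b - v, q)) := by
  have h1 := wilsonExpectation_comp_torusConfigShift ρ β v
    (fun U : GaugeConfig d L G => WilsonRP.plaqRe ρ U (a, q) * WilsonRP.plaqRe ρ U (b, q))
  have h2 := wilsonExpectation_comp_torusConfigShift ρ β v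
    (fun U : GaugeConfig d L G => WilsonRP.plaqRe ρ U (a, q))
  have h3 := wilsonExpectation_comp_torusConfigShift ρ β v
    (fun U : GaugeConfig d L G => WilsonRP.plaqRe ρ U (b, q))
  simp only [Function.comp_def, plaqRe_torusConfigShift] at h1 h2 h3
  rw [h1, h2, h3]

/-- Symmetry of plaquette covariances. [folklore] -/
theorem cov_symm (β : ℝ) (a b : Site d L) (q : {p : Fin d × Fin d // p.1 < p.2}) :
    wilsonExpectation ρ β (fun U : GaugeConfig d L G =>
        WilsonRP.plaqRe ρ U (a, q) * WilsonRP.plaqRe ρ U (b, q))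
      - wilsonExpectation ρ β (fun U : GaugeConfig d L G => WilsonRP.plaqRe ρ U (a, q))
        * wilsonExpectation ρ β (fun U : GaugeConfig d L G => WilsonRP.plaqRe ρ U (b, q)) =
    wilsonExpectation ρ β (fun U : GaugeConfig d L G =>
        WilsonRP.plaqRe ρ U (b, q) * WilsonRP.plaqRe ρ U (a, q))
      - wilsonExpectation ρ β (fun U : GaugeConfig d L G => WilsonRP.plaqRe ρ U (b, q))
        * wilsonExpectation ρ β (fun U : GaugeConfig d L G => WilsonRP.plaqRe ρ U (a, q)) := by
  have h : (fun U : GaugeConfig d L G => WilsonRP.plaqRe ρ U (a, q) * WilsonRP.plaqRe ρ U (b, q)) =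
      fun U => WilsonRP.plaqRe ρ U (b, q) * WilsonRP.plaqRe ρ U (a, q) := by
    funext U; ring
  rw [h, mul_comm (wilsonExpectation ρ β fun U : GaugeConfig d L G => WilsonRP.plaqRe ρ U (a, q))]

/-- The variance of a plaquette is non-negative. [folklore] -/
theorem var_plaqRe_nonneg (hρ : Continuous ρ) (β : ℝ) (p : Plaquette d L) :
    0 ≤ wilsonExpectation ρ β (fun U : GaugeConfig d L G =>
        WilsonRP.plaqRe ρ U p * WilsonRP.plaqRe ρ U p)
      - wilsonExpectation ρ β (fun U : GaugeConfig d L G => WilsonRP.plaqRe ρ U p)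
        * wilsonExpectation ρ β (fun U : GaugeConfig d L G => WilsonRP.plaqRe ρ U p) := by
  haveI := isProbabilityMeasure_wilsonMeasure (d := d) (L := L) ρ hρ β
  have hFb : ∃ C : ℝ, ∀ U : GaugeConfig d L G, |WilsonRP.plaqRe ρ U p| ≤ C :=
    ⟨N, fun U => WilsonRP.abs_plaqRe_le ρ hρ U p⟩
  have hc : 0 ≤ ∫ U, (WilsonRP.plaqRe ρ (id U) p -
      ∫ V, WilsonRP.plaqRe ρ V p ∂(wilsonMeasure (d := d) (L := L) ρ β)) *
        (WilsonRP.plaqRe ρ U p - ∫ V, WilsonRP.plaqRe ρ V p ∂(wilsonMeasure (d := d) (L := L) ρ β))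
      ∂(wilsonMeasure (d := d) (L := L) ρ β) :=
    integral_nonneg fun U => mul_self_nonneg _
  exact cov_comp_nonneg_of_centred (μ := wilsonMeasure (d := d) (L := L) ρ β) (Θ := id)
    measurable_id Measure.map_id (WilsonRP.measurable_plaqRe ρ hρ p) hFb hc

omit [NeZero L] in
/-- `Cov(c − A, c − B) = Cov(A, B)` for bounded measurable `A, B` on a probability space. [folklore] -/
theorem cov_const_sub {Ω : Type*} [MeasurableSpace Ω] (μ : Measure Ω) [IsProbabilityMeasure μ]
    {A B : Ω → ℝ} (hA : Measurable A) (hB : Measurable B) (hAb : ∃ C : ℝ, ∀ ω, |A ω| ≤ C)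
    (hBb : ∃ C : ℝ, ∀ ω, |B ω| ≤ C) (c : ℝ) :
    ∫ ω, (c - A ω) * (c - B ω) ∂μ - (∫ ω, (c - A ω) ∂μ) * ∫ ω, (c - B ω) ∂μ =
      ∫ ω, A ω * B ω ∂μ - (∫ ω, A ω ∂μ) * ∫ ω, B ω ∂μ := by
  obtain ⟨CA, hCA⟩ := hAb
  obtain ⟨CB, hCB⟩ := hBb
  have iA : Integrable A μ := Integrable.of_bound hA.aestronglyMeasurable CA
    (ae_of_all _ fun ω => by rw [Real.norm_eq_abs]; exact hCA ω)
  have iB : Integrable B μ := Integrable.of_bound hB.aestronglyMeasurable CB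
    (ae_of_all _ fun ω => by rw [Real.norm_eq_abs]; exact hCB ω)
  have iAB : Integrable (fun ω => A ω * B ω) μ := by
    refine Integrable.of_bound (hA.mul hB).aestronglyMeasurable (CA * CB) (ae_of_all _ fun ω => ?_)
    rw [Real.norm_eq_abs, abs_mul]
    exact mul_le_mul (hCA _) (hCB _) (abs_nonneg _) ((abs_nonneg _).trans (hCA ω))
  have hexp : (fun ω => (c - A ω) * (c - B ω)) =
      fun ω => (A ω * B ω - c * A ω) - (c * B ω - c * c) := by
    funext ω; ring
  have i1 : Integrable (fun ω => A ω * B ω - c * A ω) μ := iAB.sub (iA.const_mul c)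
  have i2 : Integrable (fun ω => c * B ω - c * c) μ := (iB.const_mul c).sub (integrable_const _)
  rw [hexp, integral_sub i1 i2, integral_sub iAB (iA.const_mul c),
    integral_sub (iB.const_mul c) (integrable_const _), integral_const_mul, integral_const_mul,
    integral_sub (integrable_const c) iA, integral_sub (integrable_const c) iB]
  simp only [integral_const, probReal_univ, smul_eq_mul, one_mul]
  ring

end Transport

/-! ## The axis covariance on the time axis, then in the crux's coordinates -/

section Axis

variable {L N : ℕ} [NeZero L] {G : Type*} [Group G] [TopologicalSpace G]
  [IsTopologicalGroup G] [CompactSpace G] [MeasurableSpace G] [BorelSpace G]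
  (ρ : G →* Matrix (Fin N) (Fin N) ℂ)

omit [NeZero L] in
/-- Time coordinate of the axis site `t e₀` for `t < L`. [folklore] -/
theorem val_single_zero {d : ℕ} {t : ℕ} (ht : t < L) :
    ((Pi.single (0 : Fin (d + 1)) ((t : ℕ) : ZMod L) : Site (d + 1) L) 0).val = t := by
  rw [Pi.single_eq_same, ZMod.val_natCast, Nat.mod_eq_of_lt ht]

/-- **Time-axis form.** For every compact `G`, continuous `ρ`, `β ≥ 0`, every spatial plane `q`
(`q.1 ≠ 0`) and every `n`: `Cov(P_0^{q}, P_{n e₀}^{q}) ≥ 0` on the torus `(ℤ/L)^{d+1}`, `d + 1 ≥ 1`.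
Cases: `n ≡ 0` variance; `L` even: link (odd `n`) / site (even `n`) mirror pairs; `L` odd: odd-torus
mirror pairs at separation `n` (odd `n`) or `L − n` (even `n`), translated back to the origin. [folklore] -/
theorem timeAxisCov_nonneg {d : ℕ} (hρ : Continuous ρ) {β : ℝ} (hβ : 0 ≤ β)
    (q : {p : Fin (d + 1) × Fin (d + 1) // p.1 < p.2}) (hq : q.1.1 ≠ 0) (n : ℕ) :
    0 ≤ wilsonExpectation ρ β (fun U : GaugeConfig (d + 1) L G =>
        WilsonRP.plaqRe ρ U ((0 : Site (d + 1) L), q) *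
          WilsonRP.plaqRe ρ U ((Pi.single (0 : Fin (d + 1)) ((n : ℕ) : ZMod L) : Site (d + 1) L), q))
      - wilsonExpectation ρ β (fun U : GaugeConfig (d + 1) L G =>
          WilsonRP.plaqRe ρ U ((0 : Site (d + 1) L), q))
        * wilsonExpectation ρ β (fun U : GaugeConfig (d + 1) L G =>
          WilsonRP.plaqRe ρ U ((Pi.single (0 : Fin (d + 1)) ((n : ℕ) : ZMod L) : Site (d + 1) L), q)) := by
  have hL0 : 0 < L := Nat.pos_of_ne_zero (NeZero.ne L)
  -- reduce to `n < L`
  rw [← ZMod.natCast_mod n L]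
  set n' := n % L with hn'
  have hn'L : n' < L := Nat.mod_lt n hL0
  clear_value n'
  clear hn' n
  rcases Nat.eq_zero_or_pos n' with rfl | hn1
  · -- variance
    simp only [Nat.cast_zero, Pi.single_zero]
    exact var_plaqRe_nonneg ρ hρ β _
  -- the generic translation step: from a mirror pair `(a, b)` with `b - a = n' e₀` to the origin
  have finish : ∀ (a b : Site (d + 1) L),
      b - a = Pi.single (0 : Fin (d + 1)) ((n' : ℕ) : ZMod L) →
      0 ≤ wilsonExpectation ρ β (fun U : GaugeConfig (d + 1) L G =>
          WilsonRP.plaqRe ρ U (a, q) * WilsonRP.plaqRe ρ U (b, q))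
        - wilsonExpectation ρ β (fun U : GaugeConfig (d + 1) L G => WilsonRP.plaqRe ρ U (a, q))
          * wilsonExpectation ρ β (fun U : GaugeConfig (d + 1) L G => WilsonRP.plaqRe ρ U (b, q)) →
      0 ≤ wilsonExpectation ρ β (fun U : GaugeConfig (d + 1) L G =>
          WilsonRP.plaqRe ρ U ((0 : Site (d + 1) L), q) *
            WilsonRP.plaqRe ρ U ((Pi.single (0 : Fin (d + 1)) ((n' : ℕ) : ZMod L) : Site (d + 1) L), q))
        - wilsonExpectation ρ β (fun U : GaugeConfig (d + 1) L G =>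
            WilsonRP.plaqRe ρ U ((0 : Site (d + 1) L), q))
          * wilsonExpectation ρ β (fun U : GaugeConfig (d + 1) L G =>
            WilsonRP.plaqRe ρ U ((Pi.single (0 : Fin (d + 1)) ((n' : ℕ) : ZMod L) : Site (d + 1) L), q)) := by
    intro a b hab h
    rw [cov_translate ρ β a b a q, sub_self, hab] at h
    exact h
  rcases Nat.even_or_odd L with hL | hL
  · -- even torus
    rcases Nat.even_or_odd n' with hn | hn
    · -- even separation: site mirror pair at `t = n'/2`
      obtain ⟨t, rfl⟩ := hn
      obtain ⟨r, hr⟩ := hL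
      have ht1 : 1 ≤ t := by omega
      have htL : t < L := by omega
      have ht2 : t < L / 2 := by omega
      set p : Plaquette (d + 1) L := ((Pi.single (0 : Fin (d + 1)) ((t : ℕ) : ZMod L)), q) with hp
      have hv : (p.1 0).val = t := by simp only [hp]; exact val_single_zero htL
      have h := cov_negReflect_pair_nonneg ρ ⟨r, hr⟩ hρ β (p := p) hq (hv ▸ ht1) (hv ▸ ht2)
      refine finish _ _ ?_ h
      simp only [hp, negReflect_single, ← Pi.single_sub]
      congr 1
      push_cast
      ring
    · -- odd separation: link mirror pair at `t = (n'+1)/2`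
      obtain ⟨k, rfl⟩ := hn
      obtain ⟨r, hr⟩ := hL
      have htL : k + 1 < L := by omega
      have ht2 : k + 1 ≤ L / 2 := by omega
      set p : Plaquette (d + 1) L := ((Pi.single (0 : Fin (d + 1)) (((k + 1 : ℕ) : ℕ) : ZMod L)), q)
        with hp
      have hv : (p.1 0).val = k + 1 := by simp only [hp]; exact val_single_zero htL
      have h := cov_timeReflect_pair_nonneg_even ρ ⟨r, hr⟩ hρ hβ (p := p) hq (by omega) (hv ▸ ht2)
      refine finish _ _ ?_ h
      simp only [hp, timeReflect_single, ← Pi.single_sub]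
      congr 1
      push_cast
      ring
  · -- odd torus, `L ≥ 3`
    have hL3 : 3 ≤ L := by obtain ⟨r, hr⟩ := hL; omega
    rcases Nat.even_or_odd n' with hn | hn
    · -- even separation: mirror pair at separation `L - n'` (odd), then swap the two plaquettes
      obtain ⟨t, rfl⟩ := hn
      obtain ⟨r, hr⟩ := hL
      -- `L - 2t = 2s + 1` with `s = r - t`, mirror time `s + 1`
      have hs1 : r - t + 1 < L := by omega
      have hs2 : r - t + 1 ≤ L / 2 := by omega
      set p : Plaquette (d + 1) L :=
        ((Pi.single (0 : Fin (d + 1)) (((r - t + 1 : ℕ) : ℕ) : ZMod L)), q) with hp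
      have hv : (p.1 0).val = r - t + 1 := by simp only [hp]; exact val_single_zero hs1
      have h := cov_timeReflect_pair_nonneg_odd ρ ⟨r, hr⟩ hL3 hρ hβ (p := p) hq (by omega)
        (hv ▸ hs2)
      rw [cov_symm] at h
      refine finish _ _ ?_ h
      simp only [hp, timeReflect_single, ← Pi.single_sub]
      congr 1
      have hL' : ((2 * r + 1 : ℕ) : ZMod L) = 0 := by rw [← hr]; exact ZMod.natCast_self L
      have hrt : t ≤ r := by omega
      push_cast [Nat.cast_sub hrt] at hL' ⊢
      linear_combination (-1 : ZMod L) * hL'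
    · -- odd separation: mirror pair at `t = (n'+1)/2`
      obtain ⟨k, rfl⟩ := hn
      obtain ⟨r, hr⟩ := hL
      have htL : k + 1 < L := by omega
      have ht2 : k + 1 ≤ L / 2 := by omega
      set p : Plaquette (d + 1) L := ((Pi.single (0 : Fin (d + 1)) (((k + 1 : ℕ) : ℕ) : ZMod L)), q)
        with hp
      have hv : (p.1 0).val = k + 1 := by simp only [hp]; exact val_single_zero htL
      have h := cov_timeReflect_pair_nonneg_odd ρ ⟨r, hr⟩ hL3 hρ hβ (p := p) hq (by omega)
        (hv ▸ ht2)
      refine finish _ _ ?_ h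
      simp only [hp, timeReflect_single, ← Pi.single_sub]
      congr 1
      push_cast
      ring

/-- **The crux's reference pair is a time-axis pair in the `(1,2)` plane** (coordinate permutation
`σ = (0 1 2)`, tree `wilsonExpectation_comp_configPerm`, and `Cov(N − A, N − B) = Cov(A, B)`):
`Cov_{L,β}(P_0^{01}, P_{n e₂}^{01}) = Cov_{L,β}(Re tr ρ(U_{p(0;1,2)}), Re tr ρ(U_{p(n e₀;1,2)}))`. [folklore] -/
theorem cruxAxisCov_eq (hρ : Continuous ρ) (β : ℝ) (n : ℕ) :
    wilsonExpectation ρ β (fun U : GaugeConfig 4 L G =>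
          ((N : ℝ) - (ρ (plaquetteHolonomy U 0 0 1)).trace.re) *
            ((N : ℝ) - (ρ (plaquetteHolonomy U
              (Pi.single (2 : Fin 4) ((n : ℕ) : ZMod L)) 0 1)).trace.re))
        - wilsonExpectation ρ β (fun U : GaugeConfig 4 L G =>
            (N : ℝ) - (ρ (plaquetteHolonomy U 0 0 1)).trace.re)
          * wilsonExpectation ρ β (fun U : GaugeConfig 4 L G =>
            (N : ℝ) - (ρ (plaquetteHolonomy U
              (Pi.single (2 : Fin 4) ((n : ℕ) : ZMod L)) 0 1)).trace.re) =
    wilsonExpectation ρ β (fun U : GaugeConfig 4 L G =>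
        WilsonRP.plaqRe ρ U ((0 : Site 4 L), ⟨((1 : Fin 4), (2 : Fin 4)), by decide⟩) *
          WilsonRP.plaqRe ρ U ((Pi.single (0 : Fin 4) ((n : ℕ) : ZMod L) : Site 4 L),
            ⟨((1 : Fin 4), (2 : Fin 4)), by decide⟩))
      - wilsonExpectation ρ β (fun U : GaugeConfig 4 L G =>
          WilsonRP.plaqRe ρ U ((0 : Site 4 L), ⟨((1 : Fin 4), (2 : Fin 4)), by decide⟩))
        * wilsonExpectation ρ β (fun U : GaugeConfig 4 L G =>
          WilsonRP.plaqRe ρ U ((Pi.single (0 : Fin 4) ((n : ℕ) : ZMod L) : Site 4 L),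
            ⟨((1 : Fin 4), (2 : Fin 4)), by decide⟩)) := by
  haveI := isProbabilityMeasure_wilsonMeasure (d := 4) (L := L) ρ hρ β
  -- the two plaquette functions, as `plaqRe` of plaquettes in the `(0,1)` plane
  set q01 : {p : Fin 4 × Fin 4 // p.1 < p.2} := ⟨((0 : Fin 4), (1 : Fin 4)), by decide⟩ with hq01
  set q12 : {p : Fin 4 × Fin 4 // p.1 < p.2} := ⟨((1 : Fin 4), (2 : Fin 4)), by decide⟩ with hq12
  have hA : ∀ U : GaugeConfig 4 L G, (ρ (plaquetteHolonomy U 0 0 1)).trace.re =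
      WilsonRP.plaqRe ρ U ((0 : Site 4 L), q01) := fun U => rfl
  have hB : ∀ U : GaugeConfig 4 L G,
      (ρ (plaquetteHolonomy U (Pi.single (2 : Fin 4) ((n : ℕ) : ZMod L)) 0 1)).trace.re =
        WilsonRP.plaqRe ρ U ((Pi.single (2 : Fin 4) ((n : ℕ) : ZMod L) : Site 4 L), q01) :=
    fun U => rfl
  simp only [hA, hB]
  -- `Cov(N − A, N − B) = Cov(A, B)`
  have hmA := WilsonRP.measurable_plaqRe ρ hρ (((0 : Site 4 L), q01) : Plaquette 4 L)
  have hmB := WilsonRP.measurable_plaqRe ρ hρ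
    (((Pi.single (2 : Fin 4) ((n : ℕ) : ZMod L) : Site 4 L), q01) : Plaquette 4 L)
  have step1 := cov_const_sub (wilsonMeasure (d := 4) (L := L) ρ β) hmA hmB
    ⟨N, fun U => WilsonRP.abs_plaqRe_le ρ hρ U _⟩ ⟨N, fun U => WilsonRP.abs_plaqRe_le ρ hρ U _⟩ (N : ℝ)
  simp only [wilsonExpectation] at step1 ⊢
  rw [step1]
  -- transport the `(0,1)` plane / `e₂` axis to the `(1,2)` plane / time axis
  set σ : Equiv.Perm (Fin 4) := Equiv.swap (0 : Fin 4) 1 * Equiv.swap (1 : Fin 4) 2 with hσ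
  have hσ0 : σ 0 = 1 := by simp only [hσ]; decide
  have hσ1 : σ 1 = 2 := by simp only [hσ]; decide
  have hσ2 : σ 2 = 0 := by simp only [hσ]; decide
  have hs0 : sitePerm σ (0 : Site 4 L) = 0 := by
    funext j; simp only [sitePerm_apply, Pi.zero_apply]
  have hperm : ∀ (x : Site 4 L) (U : GaugeConfig 4 L G),
      WilsonRP.plaqRe ρ (configPerm σ.symm U) (x, q01) = WilsonRP.plaqRe ρ U (sitePerm σ x, q12) :=
    fun x U => by
      simp only [WilsonRP.plaqRe, hq01, hq12, plaquetteHolonomy_configPerm, Equiv.symm_symm, hσ0, hσ1]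
  have e1 := wilsonExpectation_comp_configPerm ρ hρ β σ.symm
    (fun U : GaugeConfig 4 L G => WilsonRP.plaqRe ρ U ((0 : Site 4 L), q01) *
      WilsonRP.plaqRe ρ U ((Pi.single (2 : Fin 4) ((n : ℕ) : ZMod L) : Site 4 L), q01))
  have e2 := wilsonExpectation_comp_configPerm ρ hρ β σ.symm
    (fun U : GaugeConfig 4 L G => WilsonRP.plaqRe ρ U ((0 : Site 4 L), q01))
  have e3 := wilsonExpectation_comp_configPerm ρ hρ β σ.symm
    (fun U : GaugeConfig 4 L G =>
      WilsonRP.plaqRe ρ U ((Pi.single (2 : Fin 4) ((n : ℕ) : ZMod L) : Site 4 L), q01))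
  simp only [Function.comp_def, hperm, hs0, sitePerm_single, hσ2, wilsonExpectation] at e1 e2 e3
  rw [← e1, ← e2, ← e3]

/-- **The reference axis covariance of the crux is non-negative.** For every compact group `G`,
every continuous matrix representation `ρ`, every torus `(ℤ/L)⁴`, every `β ≥ 0` and every `n : ℕ`:
`0 ≤ Cov_{L,β}(P_0^{01}, P_{n e₂}^{01})` with `P_x^{ij}(U) = N − Re tr ρ(U_{p(x;i,j)})`, written with
the crux's `let P … let E … let cov` unfolded (Osterwalder–Seiler reflection positivity, three
reflections, transported from the time axis by the coordinate permutation `(0 1 2)`). [folklore] -/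
theorem axisPlaquetteCov_nonneg (hρ : Continuous ρ) {β : ℝ} (hβ : 0 ≤ β) (n : ℕ) :
    0 ≤ wilsonExpectation ρ β (fun U : GaugeConfig 4 L G =>
          ((N : ℝ) - (ρ (plaquetteHolonomy U 0 0 1)).trace.re) *
            ((N : ℝ) - (ρ (plaquetteHolonomy U
              (Pi.single (2 : Fin 4) ((n : ℕ) : ZMod L)) 0 1)).trace.re))
        - wilsonExpectation ρ β (fun U : GaugeConfig 4 L G =>
            (N : ℝ) - (ρ (plaquetteHolonomy U 0 0 1)).trace.re)
          * wilsonExpectation ρ β (fun U : GaugeConfig 4 L G =>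
            (N : ℝ) - (ρ (plaquetteHolonomy U
              (Pi.single (2 : Fin 4) ((n : ℕ) : ZMod L)) 0 1)).trace.re) := by
  rw [cruxAxisCov_eq ρ hρ β n]
  exact timeAxisCov_nonneg (L := L) (d := 3) ρ hρ hβ _ (by decide) n

end Axis

end Summit.QuantumFields.YangMills.Theorems.FemtoCurvatureTwoPoint.AxisCovNonneg

namespace Summit.QuantumFields.YangMills.Theorems.FemtoCurvatureTwoPoint

/-- **Registered sub-goal `stub_axisCovNonneg`** (`--supports stmt-QuantumFields-9363`): the crux's
reference axis covariance `Cov_{L,β}(P_0^{01}, P_{ne₂}^{01})` is non-negative for every compact `G`,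
continuous `ρ`, torus side `L`, `β ≥ 0` and `n` (closed form of `AxisCovNonneg.axisPlaquetteCov_nonneg`,
fully qualified). [folklore] -/
theorem stub_axisCovNonneg : ∀ (L N : ℕ) [NeZero L] (G : Type) [Group G] [TopologicalSpace G] [IsTopologicalGroup G] [CompactSpace G] [MeasurableSpace G] [BorelSpace G] (ρ : G →* Matrix (Fin N) (Fin N) ℂ), Continuous ρ → ∀ (β : ℝ), 0 ≤ β → ∀ (n : ℕ), 0 ≤ Literature.MathematicalPhysics.QuantumFieldTheory.wilsonExpectation ρ β (fun U : Literature.MathematicalPhysics.QuantumFieldTheory.GaugeConfig 4 L G => ((N : ℝ) - (ρ (Literature.MathematicalPhysics.QuantumFieldTheory.plaquetteHolonomy U 0 0 1)).trace.re) * ((N : ℝ) - (ρ (Literature.MathematicalPhysics.QuantumFieldTheory.plaquetteHolonomy U (Pi.single (2 : Fin 4) ((n : ℕ) : ZMod L)) 0 1)).trace.re)) - Literature.MathematicalPhysics.QuantumFieldTheory.wilsonExpectation ρ β (fun U : Literature.MathematicalPhysics.QuantumFieldTheory.GaugeConfig 4 L G => (N : ℝ) - (ρ (Literature.MathematicalPhysics.QuantumFieldTheory.plaquetteHolonomy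 U 0 0 1)).trace.re) * Literature.MathematicalPhysics.QuantumFieldTheory.wilsonExpectation ρ β (fun U : Literature.MathematicalPhysics.QuantumFieldTheory.GaugeConfig 4 L G => (N : ℝ) - (ρ (Literature.MathematicalPhysics.QuantumFieldTheory.plaquetteHolonomy U (Pi.single (2 : Fin 4) ((n : ℕ) : ZMod L)) 0 1)).trace.re) := by
  intro L N _ G _ _ _ _ _ _ ρ hρ β hβ n
  exact AxisCovNonneg.axisPlaquetteCov_nonneg ρ hρ hβ n

end Summit.QuantumFields.YangMills.Theorems.FemtoCurvatureTwoPoint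

end
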